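import Literature.Geometry.Kaehler.ComplexTorusLefschetzInvolutionsPoincareSelfAdjoint
import Literature.Geometry.Kaehler.ComplexTorusLefschetzSL2ActionPoincareAdjoint
import HarnessLib

/-!
# The graded cup-product (Poincaré) pairing `B_e(w, w') = Σ_{k+l=2g} ⟨w_k, w'_l⟩_e` on `H•(X; ℂ)` of a complex torus, as ONE bilinear form

Layer `Literature/Geometry/Kaehler`, namespace `Literature.Geometry.Kaehler.ComplexTorus`; lane `lit-hodgefound` (Track 2 foundations library),
prover seat `lit-hodgefound-p35` (generation 51, row g51-#1). ONE DEFINITION WITH BODY (`poincarePairingG`) + proved theorems; no named fact,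
no instance, no notation (D-0026 net debt `0`).

WHY. André's §1.1–§1.2 is phrased for ONE bilinear form `(x, y) ↦ ∫_X x ∪ y` on the whole of `H*(X)`, against which operators of all degrees
(`L`, `ᶜΛ`, `*_L`, `*_H`, the `SL₂`-action) are "auto-adjoints" or have transposes. The tree's cup-product pairing of the complex torus
`X = E/Φ(ℤ^ι)` is DEGREEWISE — `poincarePairing Φ e h : Hᵏ(X; ℂ) →ₗ Hˡ(X; ℂ) →ₗ ℂ` for `k + l = N = 2g` (`ComplexTorusPoincareDuality`) — while
the Lefschetz operators live on the total space `H•(X; ℂ) = GForm E ℂ` (`lefschetzG`, `countingG`, `lefschetzDualG`, p34's abstract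
`lefschetzInvolution` / `hodgeInvolution` / `weylOperator` / `sl2Rep`). Five tree files therefore re-assembled the graded pairing PRIVATELY
(`exists_gradedPairing₆₃/₆₅/₇₀/₇₅`, `gradedWeylForm…₉₁`) to read p34's abstract adjointness theorems (`Algebra/Lie/LefschetzModuleSelfAdjoint`,
`…WeylOperatorSelfAdjoint`, `…SL2RepresentationFunctoriality`). This file makes the graded pairing a PUBLIC object once, with its evaluation
rules, and records André's whole list against it as `LinearMap.IsSelfAdjoint` / `IsSkewAdjoint` / `IsAdjointPair` statements (one-liners from
the abstract rows), its graded symmetry, its non-degeneracy and its `ℚ`-values on `H•(X; ℚ)`.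

## Sources, VERBATIM

* Y. André, *Pour une théorie inconditionnelle des motifs*, Publ. Math. IHÉS 83 (1996) [Andre1996Motifs] (held `paper:doi-10-1007-bf02698643`),
  §1.1 (p. 11 = p0008 L12–L14): "Remarquons aussi que `L`, `*_L`, `*_H` et `ᶜΛ` sont auto-adjoints relativement à l'accouplement de dualité de
  Poincaré `(x, y) ↦ ∫ x ∪ y`."; Prop. 1.2 (p. 11 = p0008 L62–L66): "ces algèbres [`ℚ[L, ᶜΛ]` …] […] Via cet isomorphisme, la transposition
  relative à la forme bilinéaire `(x, y) ↦ ∫ x ∪ * y` correspond à la transposition des matrices".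
* H. Lange, *Abelian Varieties over the Complex Numbers* (2023) [Lange2023AbelianVarietiesComplex], §1.4.1 (p. 37: `H•(X, ℤ) = ⋀• Hom(Λ, ℤ)` with
  the cup product = exterior product), §1.1.3 Lemma 1.1.17 (b) (graded commutativity), §6.2.4 (p. 310: "the cup product pairing
  `Hᵖ(X, ℤ) ⊗ H^{2g-p}(X, ℤ) → H^{2g}(X, ℤ) ≃ ℤ` yields the Poincaré duality").
* E. Looijenga, V. Lunts, *A Lie algebra attached to a projective variety*, Invent. Math. 129 (1997) [LooijengaLunts1997], §1 (1.3) p. 5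
  (`SL₂` and the invariant form).

## Contents (`B = poincarePairingG Φ e`, `e : Fin N ≃ ι` an orientation of the lattice basis, `N = 2g`)

* §1 `poincarePairingG` (the sum over `k ≤ N` of `⟨pr_k ·, pr_{N-k} ·⟩_e`), `poincarePairingG_apply` (`B(w, w') = Σ_k ⟨w_k, w'_{N-k}⟩`),
  **`poincarePairingG_of_of`** (`B(of k x, of l y) = ⟨x, y⟩_e` for `k + l = N`), `poincarePairingG_of_of_of_ne` (`= 0` otherwise),
  `poincarePairingG_apply_of`, `poincarePairingG_of_apply` (mixed), `isAdjointPair_poincarePairingG_of_forall_of` (adjointness is detected on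
  homogeneous elements).
* §2 GRADED SYMMETRY **`poincarePairingG_apply_of_comm`: `B(w, of k x) = (-1)ᵏ B(of k x, w)`** (`(-1)^{kl} = (-1)ᵏ` as `k + l = 2g`).
* §3 ANDRÉ'S LIST: `isSkewAdjoint_poincarePairingG_countingG` (`H`), **`isSelfAdjoint_poincarePairingG_lefschetzG`** (`L_η`, any real `2`-form)
  and `_pow`, **`isSelfAdjoint_poincarePairingG_lefschetzDualG`** (`Λ_η = ᶜΛ`, `η` non-degenerate), **`…_lefschetzInvolution`** (`*_L`),
  **`…_hodgeInvolution`** (Kleiman–Milne's `∗`), `…_conj_lefschetzInvolution` (André's `ᶜL`), **`…_andreHodgeInvolution`** (`*_H`),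
  **`…_weylOperator`** (`w`), `isOrthogonal_poincarePairingG_lefschetzInvolution` / `_hodgeInvolution` (`*_L`, `∗` are isometries),
  **`isAdjointPair_poincarePairingG_sl2Rep`** (`ρ(a b ; c d)ᵀ = ρ(d b ; c a)`), **`exists_mem_adjoin_isAdjointPair_poincarePairingG`**
  (`ℂ[L_η, Λ_η]` is stable under transposition).
* §4 **`poincarePairingG_nondegenerate`** (Poincaré duality, all degrees at once).
* §5 **`poincarePairingG_mem_range_rat`** (`B(H•(X; ℚ), H•(X; ℚ)) ⊆ ℚ`).

## Not here

Kleiman's forms `(x, y) ↦ B(x, *_L y)`, `B(x, ∗y)` and the "transposition des matrices" clause of Prop. 1.2 on the torus: the sequel row.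
The degreewise statements stay where they are (`poincarePairing_lefschetzPow_one_comm`, `poincarePairing_weylOperator_comm`, …); nothing is restated
degreewise.
-/

noncomputable section

-- `Module ℂ` / `SMulZeroClass ℂ` synthesis on `E [⋀^Fin k]→L[ℝ] ℂ` (as in `ComplexTorusLefschetzDecomposition`)
set_option maxSynthPendingDepth 3

namespace Literature.Geometry.Kaehler

namespace ComplexTorus

open Module Function Finset
open scoped MatrixGroups
open Literature.LinearAlgebra.Alternating Literature.Algebra.Lie

universe uE

variable {ι : Type*} [Fintype ι] [DecidableEq ι] {E : Type uE} [NormedAddCommGroup E] [NormedSpace ℂ E] [FiniteDimensional ℂ E]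
  [Nontrivial E] (Φ : (ι → ℝ) ≃L[ℝ] E) {η : E [⋀^Fin 2]→L[ℝ] ℝ} {N : ℕ}

/-! ## §1 The graded pairing and its evaluation rules -/

section Definition

omit [Fintype ι] [FiniteDimensional ℂ E] [Nontrivial E] in
/-- A degree bookkeeping: `k + (N - k) = N` for `k : Fin (N + 1)`. [folklore] -/
private theorem fin_add_sub_eq (k : Fin (N + 1)) : (k : ℕ) + (N - k) = N :=
  Nat.add_sub_cancel' (Nat.le_of_lt_succ k.isLt)

/-- **The graded cup-product (Poincaré) pairing `B_e(w, w') = Σ_{k=0}^{N} ⟨w_k, w'_{N-k}⟩_e` on `H•(X; ℂ) = GForm E ℂ`** of the complex torus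
`X = E/Φ(ℤ^ι)`, relative to an orientation `e : Fin N ≃ ι` of the lattice basis (`N = rk Λ = 2 dim X`): the sum of the tree's degreewise cup-product
pairings `poincarePairing Φ e h : Hᵏ ⊗ H^{N-k} → ℂ` composed with the two projections — André's "accouplement de dualité de Poincaré
`(x, y) ↦ ∫ x ∪ y`" on the whole of `H*(X)`, pairing complementary degrees and vanishing on the others.
[cite: Andre1996Motifs, §1.1 (p. 11)] [cite: Lange2023AbelianVarietiesComplex, §1.4.1 (p. 37), §6.2.4 (p. 310)] -/
def poincarePairingG (e : Fin N ≃ ι) : LinearMap.BilinForm ℂ (GForm E ℂ) :=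
  ∑ k : Fin (N + 1), (poincarePairing Φ e (fin_add_sub_eq k)).compl₁₂
    (LinearMap.proj (R := ℂ) (φ := fun m ↦ E [⋀^Fin m]→L[ℝ] ℂ) (k : ℕ))
    (LinearMap.proj (R := ℂ) (φ := fun m ↦ E [⋀^Fin m]→L[ℝ] ℂ) (N - k))

omit [Fintype ι] [FiniteDimensional ℂ E] [Nontrivial E] in
/-- Unfolding: **`B_e(w, w') = Σ_{k=0}^{N} ⟨w_k, w'_{N-k}⟩_e`**. [cite: Andre1996Motifs, §1.1 (p. 11)] -/
theorem poincarePairingG_apply (e : Fin N ≃ ι) (w w' : GForm E ℂ) :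
    poincarePairingG Φ e w w' = ∑ k : Fin (N + 1), poincarePairing Φ e (fin_add_sub_eq k) (w k) (w' (N - k)) := by
  simp only [poincarePairingG, LinearMap.sum_apply, LinearMap.compl₁₂_apply, LinearMap.proj_apply]

omit [Fintype ι] [FiniteDimensional ℂ E] [Nontrivial E] in
/-- Transport of the right degree along an equation (plumbing). [folklore] -/
private theorem poincarePairing_of_apply_right (e : Fin N ≃ ι) {k l l' : ℕ} (h' : k + l' = N) (h : k + l = N) (x : E [⋀^Fin k]→L[ℝ] ℂ)
    (y : E [⋀^Fin l]→L[ℝ] ℂ) : poincarePairing Φ e h' x (GForm.of l y l') = poincarePairing Φ e h x y := by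
  obtain rfl : l' = l := by omega
  rw [GForm.of_apply_self]

omit [Fintype ι] [FiniteDimensional ℂ E] [Nontrivial E] in
/-- Transport of the left degree along an equation (plumbing). [folklore] -/
private theorem poincarePairing_of_apply_left (e : Fin N ≃ ι) {k k' l : ℕ} (h' : k' + l = N) (h : k + l = N) (x : E [⋀^Fin k]→L[ℝ] ℂ)
    (y : E [⋀^Fin l]→L[ℝ] ℂ) : poincarePairing Φ e h' (GForm.of k x k') y = poincarePairing Φ e h x y := by
  obtain rfl : k' = k := by omega
  rw [GForm.of_apply_self]

omit [Fintype ι] [FiniteDimensional ℂ E] [Nontrivial E] in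
/-- **Mixed evaluation, right: `B_e(w, of l y) = ⟨w_k, y⟩_e`** for `k + l = N` (only the component of `w` of complementary degree pairs with a
homogeneous class). [cite: Andre1996Motifs, §1.1 (p. 11)] [cite: Lange2023AbelianVarietiesComplex, §6.2.4 (p. 310)] -/
theorem poincarePairingG_apply_of (e : Fin N ≃ ι) {k l : ℕ} (h : k + l = N) (w : GForm E ℂ) (y : E [⋀^Fin l]→L[ℝ] ℂ) :
    poincarePairingG Φ e w (GForm.of l y) = poincarePairing Φ e h (w k) y := by
  rw [poincarePairingG_apply, Finset.sum_eq_single_of_mem (⟨k, by omega⟩ : Fin (N + 1)) (Finset.mem_univ _) fun k' _ hk' ↦ ?_]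
  · exact poincarePairing_of_apply_right Φ e _ h (w k) y
  · have hne : N - (k' : ℕ) ≠ l := fun h'' ↦ hk' (Fin.ext (by have := k'.isLt; simp only at h'' ⊢; omega))
    rw [GForm.of_apply_of_ne hne, map_zero]

omit [Fintype ι] [FiniteDimensional ℂ E] [Nontrivial E] in
/-- **Mixed evaluation, left: `B_e(of k x, w') = ⟨x, w'_l⟩_e`** for `k + l = N`. [cite: Andre1996Motifs, §1.1 (p. 11)]
[cite: Lange2023AbelianVarietiesComplex, §6.2.4 (p. 310)] -/
theorem poincarePairingG_of_apply (e : Fin N ≃ ι) {k l : ℕ} (h : k + l = N) (x : E [⋀^Fin k]→L[ℝ] ℂ) (w' : GForm E ℂ) :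
    poincarePairingG Φ e (GForm.of k x) w' = poincarePairing Φ e h x (w' l) := by
  rw [poincarePairingG_apply, Finset.sum_eq_single_of_mem (⟨k, by omega⟩ : Fin (N + 1)) (Finset.mem_univ _) fun k' _ hk' ↦ ?_]
  · obtain rfl : N - k = l := by omega
    exact poincarePairing_of_apply_left Φ e _ h x (w' (N - k))
  · have hne : (k' : ℕ) ≠ k := fun h'' ↦ hk' (Fin.ext h'')
    rw [GForm.of_apply_of_ne hne, map_zero, LinearMap.zero_apply]

omit [Fintype ι] [FiniteDimensional ℂ E] [Nontrivial E] in
/-- **`B_e(of k x, of l y) = ⟨x, y⟩_e` for complementary degrees `k + l = N`**: on homogeneous classes the graded pairing IS the cup-product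
pairing. [cite: Andre1996Motifs, §1.1 (p. 11)] [cite: Lange2023AbelianVarietiesComplex, §6.2.4 (p. 310)] -/
theorem poincarePairingG_of_of (e : Fin N ≃ ι) {k l : ℕ} (h : k + l = N) (x : E [⋀^Fin k]→L[ℝ] ℂ) (y : E [⋀^Fin l]→L[ℝ] ℂ) :
    poincarePairingG Φ e (GForm.of k x) (GForm.of l y) = poincarePairing Φ e h x y := by
  rw [poincarePairingG_apply_of Φ e h, GForm.of_apply_self]

omit [Fintype ι] [FiniteDimensional ℂ E] [Nontrivial E] in
/-- **`B_e(of k x, of l y) = 0` unless `k + l = N`**: non-complementary degrees are orthogonal. [cite: Andre1996Motifs, §1.1 (p. 11)]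
[cite: Lange2023AbelianVarietiesComplex, §6.2.4 (p. 310)] -/
theorem poincarePairingG_of_of_of_ne (e : Fin N ≃ ι) {k l : ℕ} (h : k + l ≠ N) (x : E [⋀^Fin k]→L[ℝ] ℂ) (y : E [⋀^Fin l]→L[ℝ] ℂ) :
    poincarePairingG Φ e (GForm.of k x) (GForm.of l y) = 0 := by
  rw [poincarePairingG_apply]
  refine Finset.sum_eq_zero fun k' _ ↦ ?_
  by_cases hk' : (k' : ℕ) = k
  · have hne : N - (k' : ℕ) ≠ l := by have := k'.isLt; omega
    rw [GForm.of_apply_of_ne hne, map_zero]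
  · rw [GForm.of_apply_of_ne hk', map_zero, LinearMap.zero_apply]

omit [Fintype ι] [DecidableEq ι] [Nontrivial E] in
/-- **An adjoint pair of operators on `H•(X; ℂ) = ⊕_{k ≤ 2g} Hᵏ(X; ℂ)` is detected on homogeneous elements** (every graded form is the finite
sum of its components of degree `≤ 2g`, `sum_range_of_eq`; André defines and compares his operators "composante par composante" on this
decomposition). [cite: Huybrechts2005, §1.2 Def. 1.2.25 (`⋀* V = ⊕ₖ ⋀ᵏ V`)] [cite: Andre1996Motifs, §1.1 (p. 10)] -/
theorem isAdjointPair_of_forall_of {B : LinearMap.BilinForm ℂ (GForm E ℂ)} {S T : Module.End ℂ (GForm E ℂ)}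
    (hST : ∀ (a b : ℕ) (x : E [⋀^Fin a]→L[ℝ] ℂ) (y : E [⋀^Fin b]→L[ℝ] ℂ),
      B (S (GForm.of a x)) (GForm.of b y) = B (GForm.of a x) (T (GForm.of b y))) :
    LinearMap.IsAdjointPair B B S T := by
  intro w w'
  conv_lhs => rw [← sum_range_of_eq w, ← sum_range_of_eq w']
  conv_rhs => rw [← sum_range_of_eq w, ← sum_range_of_eq w']
  simp only [map_sum, LinearMap.sum_apply, hST]

end Definition

/-! ## §2 Graded symmetry -/

section Symmetry

omit [Fintype ι] [DecidableEq ι] [FiniteDimensional ℂ E] [Nontrivial E] in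
/-- `(-1)^{kl} = (-1)ᵏ` when `k + l` is even. [folklore] -/
private theorem neg_one_pow_mul_eq_of_add_eq {k l g : ℕ} (h : k + l = 2 * g) : (-1 : ℂ) ^ (k * l) = (-1) ^ k := by
  have h2 : Even (k * l + k) := by
    rw [← Nat.mul_add_one, Nat.even_mul, Nat.even_add_one]
    rcases Nat.even_or_odd k with hk | hk
    · exact Or.inl hk
    · right
      intro hl
      have hsum : Even (k + l) := ⟨g, by omega⟩
      exact (Nat.not_even_iff_odd.2 hk) ((Nat.even_add.1 hsum).2 hl)
  have h3 : (-1 : ℂ) ^ (k * l) * (-1) ^ k = (-1) ^ k * (-1) ^ k := by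
    rw [← pow_add, ← pow_add, h2.neg_one_pow, ← two_mul, pow_mul, neg_one_sq, one_pow]
  exact mul_right_cancel₀ (pow_ne_zero k (neg_ne_zero.2 one_ne_zero)) h3

omit [Nontrivial E] in
/-- **GRADED SYMMETRY: `B_e(w, of k x) = (-1)ᵏ B_e(of k x, w)`** for a homogeneous class `x` of degree `k` and every `w` (the cup product is
graded commutative, `⟨δ, γ⟩ = (-1)^{kl} ⟨γ, δ⟩`, and `(-1)^{kl} = (-1)ᵏ` since `k + l = 2g`): the pairing is symmetric on even classes and
antisymmetric on odd ones. [cite: Lange2023AbelianVarietiesComplex, §1.1.3 Lemma 1.1.17 (b)] [cite: Andre1996Motifs, §1.1 (p. 11)] -/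
theorem poincarePairingG_apply_of_comm (e : Fin N ≃ ι) {k : ℕ} (x : E [⋀^Fin k]→L[ℝ] ℂ) (w : GForm E ℂ) :
    poincarePairingG Φ e w (GForm.of k x) = (-1) ^ k * poincarePairingG Φ e (GForm.of k x) w := by
  have hN := finrank_complex_mul_two Φ e
  by_cases hk : k ≤ N
  · rw [poincarePairingG_apply_of Φ e (show (N - k) + k = N by omega), poincarePairingG_of_apply Φ e (show k + (N - k) = N by omega),
      poincarePairing_comm Φ e (show k + (N - k) = N by omega) (show (N - k) + k = N by omega),
      neg_one_pow_mul_eq_of_add_eq (show k + (N - k) = 2 * finrank ℂ E by omega)]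
  · rw [eq_zero_of_finrank_real_lt x (by rw [finrank_real_of_complex]; omega), GForm.of_zero, map_zero, map_zero,
      LinearMap.zero_apply, mul_zero]

omit [Nontrivial E] in
/-- **`B_e(of k x, of k' y) = (-1)ᵏ B_e(of k' y, of k x)`** (homogeneous form of the graded symmetry). [cite: Lange2023AbelianVarietiesComplex, §1.1.3 Lemma 1.1.17 (b)] -/
theorem poincarePairingG_of_of_comm (e : Fin N ≃ ι) {k k' : ℕ} (x : E [⋀^Fin k]→L[ℝ] ℂ) (y : E [⋀^Fin k']→L[ℝ] ℂ) :
    poincarePairingG Φ e (GForm.of k' y) (GForm.of k x) = (-1) ^ k * poincarePairingG Φ e (GForm.of k x) (GForm.of k' y) :=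
  poincarePairingG_apply_of_comm Φ e x (GForm.of k' y)

omit [Nontrivial E] in
/-- On homogeneous classes of EVEN degree the graded pairing is symmetric: `B_e(w, of k x) = B_e(of k x, w)` for `k` even (e.g. all cycle
classes). [cite: Lange2023AbelianVarietiesComplex, §1.1.3 Lemma 1.1.17 (b)] -/
theorem poincarePairingG_apply_of_comm_of_even (e : Fin N ≃ ι) {k : ℕ} (hk : Even k) (x : E [⋀^Fin k]→L[ℝ] ℂ) (w : GForm E ℂ) :
    poincarePairingG Φ e w (GForm.of k x) = poincarePairingG Φ e (GForm.of k x) w := by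
  rw [poincarePairingG_apply_of_comm, hk.neg_one_pow, one_mul]

end Symmetry

/-! ## §3 André's list: `H` skew; `L_η`, `Λ_η`, `*_L`, `∗`, `ᶜL`, `*_H`, `w` self-adjoint; `SL₂` transposes; `ℂ[L_η, Λ_η]` transposition-stable -/

section Andre

omit [Nontrivial E] in
/-- **`H = deg - g` IS SKEW-ADJOINT for `B_e`** (complementary degrees have opposite weights). [cite: Andre1996Motifs, §1.1 (p. 11)]
[cite: LooijengaLunts1997, §1 (1.3) p. 5] -/
theorem isSkewAdjoint_poincarePairingG_countingG (e : Fin N ≃ ι) : (poincarePairingG Φ e).IsSkewAdjoint (countingG E) := by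
  change LinearMap.IsAdjointPair (poincarePairingG Φ e) (poincarePairingG Φ e) ⇑(countingG E) ⇑(-countingG E)
  refine isAdjointPair_of_forall_of fun a b x y ↦ ?_
  rw [countingG_of, LinearMap.neg_apply, countingG_of, map_neg, ← GForm.of_smul, ← GForm.of_smul]
  by_cases h : a + b = N
  · rw [poincarePairingG_of_of Φ e h, poincarePairingG_of_of Φ e h, poincarePairing_countingG_skew Φ e h]
  · rw [poincarePairingG_of_of_of_ne Φ e h, poincarePairingG_of_of_of_ne Φ e h, neg_zero]

omit [Fintype ι] [FiniteDimensional ℂ E] [Nontrivial E] in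
/-- **"`L` […] auto-adjoint": `L_η` IS SELF-ADJOINT for `B_e`**, for EVERY real `2`-form `η` (`(η ∧ x) ∧ y = x ∧ (η ∧ y)` in top degree).
[cite: Andre1996Motifs, §1.1 (p. 11)] [cite: Huybrechts2005, §1.2 Lemma 1.2.23] -/
theorem isSelfAdjoint_poincarePairingG_lefschetzG [FiniteDimensional ℂ E] (η : E [⋀^Fin 2]→L[ℝ] ℝ) (e : Fin N ≃ ι) :
    (poincarePairingG Φ e).IsSelfAdjoint (lefschetzG η) := by
  refine isAdjointPair_of_forall_of fun a b x y ↦ ?_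
  rw [lefschetzG_of, lefschetzG_of]
  by_cases h : (a + 2) + b = N
  · rw [poincarePairingG_of_of Φ e h, poincarePairingG_of_of Φ e (show a + (b + 2) = N by omega),
      poincarePairing_lefschetzPow_one_comm Φ η e h (by omega)]
  · rw [poincarePairingG_of_of_of_ne Φ e h, poincarePairingG_of_of_of_ne Φ e (show a + (b + 2) ≠ N by omega)]

omit [Fintype ι] [Nontrivial E] in
/-- **`L_ηʲ` is self-adjoint for `B_e`** (powers of a self-adjoint operator). [cite: Andre1996Motifs, §1.1 (p. 11)] -/
theorem isSelfAdjoint_poincarePairingG_lefschetzG_pow (η : E [⋀^Fin 2]→L[ℝ] ℝ) (e : Fin N ≃ ι) (j : ℕ) :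
    (poincarePairingG Φ e).IsSelfAdjoint ⇑(lefschetzG η ^ j) :=
  isSelfAdjoint_pow (isSelfAdjoint_poincarePairingG_lefschetzG Φ η e) j

/-- **"`ᶜΛ` […] auto-adjoint": `Λ_η` IS SELF-ADJOINT for `B_e`** for every NON-DEGENERATE real `2`-form `η`, in every dimension (the `𝔰𝔩₂`-partner of
the self-adjoint `L_η` for the skew `H`; abstract row `isSelfAdjoint_dual`). [cite: Andre1996Motifs, §1.1 (p. 11)] [cite: Huybrechts2005, §1.2 Lemma 1.2.23] -/
theorem isSelfAdjoint_poincarePairingG_lefschetzDualG (hη : ∀ v : E, v ≠ 0 → ∃ w : E, η ![v, w] ≠ 0) (e : Fin N ≃ ι) :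
    (poincarePairingG Φ e).IsSelfAdjoint (lefschetzDualG η) := by
  have key := (hasLefschetzProperty_lefschetzG hη).isSelfAdjoint_dual isZGrading_countingG (isSkewAdjoint_poincarePairingG_countingG Φ e)
    (isSelfAdjoint_poincarePairingG_lefschetzG Φ η e)
  rwa [dual_lefschetzG_eq_lefschetzDualG hη] at key

/-- **"`*_L` […] auto-adjoint": André's Lefschetz involution `*_L` IS SELF-ADJOINT for `B_e`** (`η` non-degenerate; abstract row
`isSelfAdjoint_lefschetzInvolution`). [cite: Andre1996Motifs, §1.1 (p. 11)] -/
theorem isSelfAdjoint_poincarePairingG_lefschetzInvolution (hη : ∀ v : E, v ≠ 0 → ∃ w : E, η ![v, w] ≠ 0) (e : Fin N ≃ ι) :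
    (poincarePairingG Φ e).IsSelfAdjoint ((hasLefschetzProperty_lefschetzG hη).lefschetzInvolution isZGrading_countingG) :=
  (hasLefschetzProperty_lefschetzG hη).isSelfAdjoint_lefschetzInvolution isZGrading_countingG (isSkewAdjoint_poincarePairingG_countingG Φ e)
    (isSelfAdjoint_poincarePairingG_lefschetzG Φ η e)

/-- **Kleiman–Milne's `∗` IS SELF-ADJOINT for `B_e`** (every normalisation `d`; abstract row `isSelfAdjoint_hodgeInvolution`).
[cite: Andre1996Motifs, §1.1 (p. 11, "`*_H` […] auto-adjoint")] [cite: Milne1999LefschetzClasses, §5 p. 664] -/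
theorem isSelfAdjoint_poincarePairingG_hodgeInvolution (hη : ∀ v : E, v ≠ 0 → ∃ w : E, η ![v, w] ≠ 0) (e : Fin N ≃ ι) (d : ℕ) :
    (poincarePairingG Φ e).IsSelfAdjoint ((hasLefschetzProperty_lefschetzG hη).hodgeInvolution isZGrading_countingG d) :=
  (hasLefschetzProperty_lefschetzG hη).isSelfAdjoint_hodgeInvolution isZGrading_countingG d (isSkewAdjoint_poincarePairingG_countingG Φ e)
    (isSelfAdjoint_poincarePairingG_lefschetzG Φ η e)

/-- **André's `ᶜL = *_L L_η *_L` IS SELF-ADJOINT for `B_e`** ("proportionnel à `ᶜΛ` sur chaque composante de Lefschetz").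
[cite: Andre1996Motifs, §1.1 (p. 11)] -/
theorem isSelfAdjoint_poincarePairingG_conj_lefschetzInvolution (hη : ∀ v : E, v ≠ 0 → ∃ w : E, η ![v, w] ≠ 0) (e : Fin N ≃ ι) :
    (poincarePairingG Φ e).IsSelfAdjoint ⇑((hasLefschetzProperty_lefschetzG hη).lefschetzInvolution isZGrading_countingG * lefschetzG η *
      (hasLefschetzProperty_lefschetzG hη).lefschetzInvolution isZGrading_countingG) :=
  (hasLefschetzProperty_lefschetzG hη).isSelfAdjoint_conj_lefschetzInvolution isZGrading_countingG (isSkewAdjoint_poincarePairingG_countingG Φ e)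
    (isSelfAdjoint_poincarePairingG_lefschetzG Φ η e)

/-- **"`*_H` […] auto-adjoint": André's Hodge involution `*_H` IS SELF-ADJOINT for `B_e`** (every normalisation `d`; abstract row
`isSelfAdjoint_andreHodgeInvolution`). [cite: Andre1996Motifs, §1.1 (p. 11)] -/
theorem isSelfAdjoint_poincarePairingG_andreHodgeInvolution (hη : ∀ v : E, v ≠ 0 → ∃ w : E, η ![v, w] ≠ 0) (e : Fin N ≃ ι) (d : ℕ) :
    (poincarePairingG Φ e).IsSelfAdjoint ((hasLefschetzProperty_lefschetzG hη).andreHodgeInvolution isZGrading_countingG d) :=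
  (hasLefschetzProperty_lefschetzG hη).isSelfAdjoint_andreHodgeInvolution isZGrading_countingG d (isSkewAdjoint_poincarePairingG_countingG Φ e)
    (isSelfAdjoint_poincarePairingG_lefschetzG Φ η e)

/-- **The Weyl operator `w` of the Lefschetz `𝔰𝔩₂` IS SELF-ADJOINT for `B_e`** (`w = ± *_H` on each string; abstract row `isSelfAdjoint_weylOperator`).
[cite: Andre1996Motifs, §1.1–§1.2 (p. 11)] -/
theorem isSelfAdjoint_poincarePairingG_weylOperator (hη : ∀ v : E, v ≠ 0 → ∃ w : E, η ![v, w] ≠ 0) (e : Fin N ≃ ι) :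
    (poincarePairingG Φ e).IsSelfAdjoint ((hasLefschetzProperty_lefschetzG hη).weylOperator isZGrading_countingG) :=
  (hasLefschetzProperty_lefschetzG hη).isSelfAdjoint_weylOperator isZGrading_countingG (isSkewAdjoint_poincarePairingG_countingG Φ e)
    (isSelfAdjoint_poincarePairingG_lefschetzG Φ η e)

/-- **`*_L` IS AN ISOMETRY of `B_e`: `B_e(*_L w, *_L w') = B_e(w, w')`** (self-adjoint involution). [cite: Andre1996Motifs, §1.1 (pp. 10–11)] -/
theorem isOrthogonal_poincarePairingG_lefschetzInvolution (hη : ∀ v : E, v ≠ 0 → ∃ w : E, η ![v, w] ≠ 0) (e : Fin N ≃ ι) :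
    (poincarePairingG Φ e).IsOrthogonal ((hasLefschetzProperty_lefschetzG hη).lefschetzInvolution isZGrading_countingG) := fun w w' ↦ by
  rw [isSelfAdjoint_poincarePairingG_lefschetzInvolution Φ hη e w, (hasLefschetzProperty_lefschetzG hη).lefschetzInvolution_lefschetzInvolution]

/-- **`∗` IS AN ISOMETRY of `B_e`: `B_e(∗w, ∗w') = B_e(w, w')`**. [cite: Milne1999LefschetzClasses, §5 p. 664] [cite: Andre1996Motifs, §1.1 (pp. 10–11)] -/
theorem isOrthogonal_poincarePairingG_hodgeInvolution (hη : ∀ v : E, v ≠ 0 → ∃ w : E, η ![v, w] ≠ 0) (e : Fin N ≃ ι) (d : ℕ) :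
    (poincarePairingG Φ e).IsOrthogonal ((hasLefschetzProperty_lefschetzG hη).hodgeInvolution isZGrading_countingG d) := fun w w' ↦ by
  rw [isSelfAdjoint_poincarePairingG_hodgeInvolution Φ hη e d w, (hasLefschetzProperty_lefschetzG hη).hodgeInvolution_hodgeInvolution]

/-- **THE TRANSPOSE OF `ρ(a b ; c d)` FOR `B_e` IS `ρ(d b ; c a)`**: Beauville's `SL₂(ℂ)`-action attached to a non-degenerate `η` and the
anti-automorphism of `SL₂` fixing both unipotent subgroups (`exp(t L_η)`, `exp(t Λ_η)` are self-adjoint; abstract row `isAdjointPair_sl2Rep_of_coe_eq`).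
[cite: Andre1996Motifs, §1.1 (p. 11) and Prop. 1.2 (p. 11)] [cite: LooijengaLunts1997, §1 (1.3) p. 5] -/
theorem isAdjointPair_poincarePairingG_sl2Rep (hη : ∀ v : E, v ≠ 0 → ∃ w : E, η ![v, w] ≠ 0) (e : Fin N ≃ ι) (γ γ' : SL(2, ℂ))
    (hγ' : (γ' : Matrix (Fin 2) (Fin 2) ℂ) = !![(γ : Matrix (Fin 2) (Fin 2) ℂ) 1 1, (γ : Matrix (Fin 2) (Fin 2) ℂ) 0 1;
      (γ : Matrix (Fin 2) (Fin 2) ℂ) 1 0, (γ : Matrix (Fin 2) (Fin 2) ℂ) 0 0]) :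
    LinearMap.IsAdjointPair (poincarePairingG Φ e) (poincarePairingG Φ e) ((hasLefschetzProperty_lefschetzG hη).sl2Rep isZGrading_countingG γ)
      ((hasLefschetzProperty_lefschetzG hη).sl2Rep isZGrading_countingG γ') :=
  (hasLefschetzProperty_lefschetzG hη).isAdjointPair_sl2Rep_of_coe_eq isZGrading_countingG (isSkewAdjoint_poincarePairingG_countingG Φ e)
    (isSelfAdjoint_poincarePairingG_lefschetzG Φ η e) γ γ' hγ'

/-- **`ℂ[L_η, Λ_η]` IS STABLE UNDER `B_e`-TRANSPOSITION**: every `T` in the Lefschetz–Kleiman algebra has a `B_e`-adjoint `T'` in it (`L_η`, `Λ_η` are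
self-adjoint; transposes of sums and products). [cite: Andre1996Motifs, §1.1 (p. 11) and Prop. 1.2 (pp. 11–12)] -/
theorem exists_mem_adjoin_isAdjointPair_poincarePairingG (hη : ∀ v : E, v ≠ 0 → ∃ w : E, η ![v, w] ≠ 0) (e : Fin N ≃ ι)
    {T : Module.End ℂ (GForm E ℂ)} (hT : T ∈ Algebra.adjoin ℂ ({lefschetzG η, lefschetzDualG η} : Set (Module.End ℂ (GForm E ℂ)))) :
    ∃ T' ∈ Algebra.adjoin ℂ ({lefschetzG η, lefschetzDualG η} : Set (Module.End ℂ (GForm E ℂ))),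
      LinearMap.IsAdjointPair (poincarePairingG Φ e) (poincarePairingG Φ e) T T' := by
  rw [← dual_lefschetzG_eq_lefschetzDualG hη] at hT ⊢
  exact (hasLefschetzProperty_lefschetzG hη).exists_isAdjointPair_of_mem_adjoin_pair_dual isZGrading_countingG
    (isSkewAdjoint_poincarePairingG_countingG Φ e) (isSelfAdjoint_poincarePairingG_lefschetzG Φ η e) hT

end Andre

/-! ## §4 Non-degeneracy -/

section Nondegenerate

omit [Nontrivial E] in
/-- **POINCARÉ DUALITY, ALL DEGREES AT ONCE: `B_e` IS NON-DEGENERATE** on `H•(X; ℂ)` (degreewise perfectness of the cup-product pairing,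
`eq_zero_of_forall_right_poincarePairing_eq_zero` / `…_left_…`; components of degree `> 2g` vanish). [cite: Lange2023AbelianVarietiesComplex, §6.2.4 (p. 310)] -/
theorem poincarePairingG_nondegenerate (e : Fin N ≃ ι) : (poincarePairingG Φ e).Nondegenerate := by
  have hN := finrank_complex_mul_two Φ e
  refine ⟨fun w hw ↦ funext fun k ↦ ?_, fun w hw ↦ funext fun k ↦ ?_⟩
  · by_cases hk : k ≤ N
    · refine eq_zero_of_forall_right_poincarePairing_eq_zero Φ e (show k + (N - k) = N by omega) fun δ ↦ ?_
      rw [← poincarePairingG_apply_of Φ e (show k + (N - k) = N by omega) w δ]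
      exact hw _
    · exact eq_zero_of_finrank_real_lt (w k) (by rw [finrank_real_of_complex]; omega)
  · by_cases hk : k ≤ N
    · refine eq_zero_of_forall_left_poincarePairing_eq_zero Φ e (show (N - k) + k = N by omega) fun γ ↦ ?_
      rw [← poincarePairingG_of_apply Φ e (show (N - k) + k = N by omega) γ w]
      exact hw _
    · exact eq_zero_of_finrank_real_lt (w k) (by rw [finrank_real_of_complex]; omega)

omit [Nontrivial E] in
/-- Non-degeneracy, pointwise: `B_e(w, w') = 0` for all `w'` forces `w = 0`. [cite: Lange2023AbelianVarietiesComplex, §6.2.4 (p. 310)] -/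
theorem eq_zero_of_forall_poincarePairingG_eq_zero (e : Fin N ≃ ι) {w : GForm E ℂ} (hw : ∀ w' : GForm E ℂ, poincarePairingG Φ e w w' = 0) :
    w = 0 :=
  (poincarePairingG_nondegenerate Φ e).1 w hw

omit [Nontrivial E] in
/-- Non-degeneracy, pointwise, on the right: `B_e(w, w') = 0` for all `w` forces `w' = 0`. [cite: Lange2023AbelianVarietiesComplex, §6.2.4 (p. 310)] -/
theorem eq_zero_of_forall_poincarePairingG_eq_zero' (e : Fin N ≃ ι) {w' : GForm E ℂ} (hw : ∀ w : GForm E ℂ, poincarePairingG Φ e w w' = 0) :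
    w' = 0 :=
  (poincarePairingG_nondegenerate Φ e).2 w' hw

end Nondegenerate

/-! ## §5 `ℚ`-values on `H•(X; ℚ)` -/

section Rational

omit [Fintype ι] [FiniteDimensional ℂ E] [Nontrivial E] in
/-- **`B_e(H•(X; ℚ), H•(X; ℚ)) ⊆ ℚ`**: the graded pairing of two rational graded classes is a rational number (degreewise
`poincarePairing_mem_range_rat`). [cite: Lange2023AbelianVarietiesComplex, §6.2.4 (p. 310)] -/
theorem poincarePairingG_mem_range_rat (e : Fin N ≃ ι) {w w' : GForm E ℂ} (hw : w ∈ rationalFormsG Φ) (hw' : w' ∈ rationalFormsG Φ) :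
    ∃ q : ℚ, poincarePairingG Φ e w w' = q := by
  choose q hq using fun k : Fin (N + 1) ↦
    poincarePairing_mem_range_rat Φ e (fin_add_sub_eq k) ((mem_rationalFormsG_iff Φ).1 hw k) ((mem_rationalFormsG_iff Φ).1 hw' (N - k))
  refine ⟨∑ k, q k, ?_⟩
  rw [poincarePairingG_apply, Rat.cast_sum]
  exact Finset.sum_congr rfl fun k _ ↦ hq k

omit [Fintype ι] [FiniteDimensional ℂ E] [Nontrivial E] in
/-- A rational operator `T ∈ 𝔤𝔩(H•(X; ℚ))` has rational matrix coefficients for `B_e`: `B_e(T w, w') ∈ ℚ` for `w, w' ∈ H•(X; ℚ)`.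
[cite: LooijengaLunts1997, §1 (1.7)] [cite: Lange2023AbelianVarietiesComplex, §6.2.4 (p. 310)] -/
theorem poincarePairingG_apply_mem_range_rat_of_mem_rationalEnd (e : Fin N ≃ ι) {T : Module.End ℂ (GForm E ℂ)} (hT : T ∈ rationalEnd Φ)
    {w w' : GForm E ℂ} (hw : w ∈ rationalFormsG Φ) (hw' : w' ∈ rationalFormsG Φ) : ∃ q : ℚ, poincarePairingG Φ e (T w) w' = q :=
  poincarePairingG_mem_range_rat Φ e (hT w hw) hw'

end Rational

end ComplexTorus

end Literature.Geometry.Kaehler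

end
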